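import Mathlib
import HarnessLib
import Summits.HubbardSuperconductivity.HubbardSuperconductivity.Theorems.KLProgrammeKLRegimeTwoVolumeTowerStepCovZeroIncrL1
import Summits.HubbardSuperconductivity.HubbardSuperconductivity.Theorems.KLProgrammeKLRegimeTwoVolumeTowerStepCovZeroPullback
import Summits.HubbardSuperconductivity.HubbardSuperconductivity.Theorems.KLProgrammeKLRegimeSectorSubEntrySum

/-!
# K3 VL child (stmt-HubbardSuperconductivity-20440), atom `HmisCov` at the FIRST step (`j = 0`, «HmisZero»), part 1 (MODEL LEVEL): entries, rows and columns of
# the TWO-FRAME increment `klStepCov V M β μ K′ 0 − klStepCov V M β μ K 0` from the frames' jet data — plain `ℓ¹` (no decay weight) and an `M`-free entry sup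

Cell `gate-hubbard-kl`, seat p3 (g19).  The window-key interface of record (`…VolumeLimitV11TowerDataWOfGridMCov`, k3c4-p1 g17) reads the step-covariance
frame mismatch `klStepCov (bL) M β μ K_{bL} j − klStepCov (bL) M β μ K_L j` through three rates: entries `≤ sE j L` (uniform in `M`), rows `≤ cR j L/ε_M`,
columns `≤ cC j L/ε_M`.  The steps `1 ≤ j < n_β` are k3c4-p1's `hmisCovRowsPos_of_towerP` (covariance piece + family piece of p3 g16's #23 telescope).  At
`j = 0` the fat multiplier is the radial plateau, so (p3 g17, `klStepCov_zero_sub_eq`) the increment is EXACTLY the constant-multiplier pull-back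
`S(𝟙)ᵀ·N((βV²)⁻²(Ψ̂[K′] − Ψ̂[K]))·S(𝟙)` — no family piece — and this file reads it twice:

* §1 ENTRIES: `norm_sliceSymbolFreqIncr_le` (pointwise `‖Ψ̂[K′] − Ψ̂[K]‖ ≤ (16·(32/3)+16)·c/Λ₂²·P₀` from `|e_{K′} − e_K| ≤ P₀`, Literature
  `norm_sliceSymbolFnXi_sub_le`), `card_shell_freqMomentum_le` (the closed shell `{|ω| ≤ Λ₁} × {|e_K| ≤ Λ₁}` of an admissible frame has
  `≤ (Λ₁β/π+3)(1793Λ₁V²+704V)` points), `sum_norm_sliceSymbolFreqIncr_le` (support ⊆ shell[K] ∪ shell[K′]), hence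
  **`norm_klStepCov_zero_sub_apply_le`** / **`norm_klStepCov_zero_sub_apply_le_unif`**: every entry of the increment is `≤ 𝒞ₑ·P₀` with the ABSOLUTE
  `𝒞ₑ = 2(Λ₁/π+3)(1793Λ₁+704)(16·(32/3)+16)/Λ₂²` (`β ≥ 1`; k3c2-p2's `norm_sectorSub_pullback_normalCovariance_le_of_sum` at `F = 𝟙`) — volume- and `M`-free;
* §2 ROWS / COLUMNS: **`rowCol_klStepCov_zero_sub_le_of_jets`** — in the two-scale class `(G₀, x)` of p3 g17's `incrSlice_wt_l1_le` (base frame `FrameOK` with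
  `‖D³e_K‖ ≤ K₃ˢ·x`, increment jets `≤ G₀/x², G₀/x, G₀, G₀·x`, `klBetaMin ≤ β ≤ M`) the PLAIN rows and columns are `≤ 16·Cd·(M/β)·(G₀/x)` (weight `1 ≤` p3 g17's
  decay weight; `rowSumWt_/colSumWt_klStepCov_zero_sub_le` at `w = 1`).  The unweighted currency is what `HmisCov` asks, so the top flow frame's third jet
  (`≲ 4^{n_β+1}`) may be put into `x` — no frame telescope is needed here (contrast «SCALE-0-STEPCOV»).

Part 2 (`…VolumeLimitV11HmisCovZeroOfTowerP`) instantiates both at `K = K_L`, `K′ = K_{bL}` under `TowerP`.  Everything is proved; no definitions, no sorry.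
Nothing asserts HmisCov, any stub, K3, VL or superconductivity.  [cite: BenfattoGiulianiMastropietro2006, §2.7 (2.66)–(2.67), §2.8 (2.80), §3 (3.2)–(3.3)]
-/

noncomputable section

namespace Summit.HubbardSuperconductivity.HubbardSuperconductivity.Theorems.TorusFourierL2

set_option linter.dupNamespace false -- summit = problem name (single-conjunct summit), D-0017

open Set Finset Literature.MathematicalPhysics.QuantumLattice Literature.MathematicalPhysics.QuantumLattice.BandSectorCounting
open Literature.MathematicalPhysics.QuantumLattice.FermiRG Literature.Probability.LatticeModels Literature.Analysis.SpecialFunctions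
open Summit.HubbardSuperconductivity.HubbardSuperconductivity.Theorems.DispersionFlow
open Summit.HubbardSuperconductivity.HubbardSuperconductivity.Theorems.KLRegimeSplit
open Summit.HubbardSuperconductivity.HubbardSuperconductivity.Theorems.KLProgrammeLegKernels
open Summit.HubbardSuperconductivity.HubbardSuperconductivity.Theorems.PerturbedFermiCurve
open Summit.HubbardSuperconductivity.HubbardSuperconductivity.Theorems.KLRegimeWick
open Summit.HubbardSuperconductivity.HubbardSuperconductivity.Theorems.TwoVolumeSource
open scoped Real Nat

open Classical

/-! ## §1 Entries of the two-frame increment of the first step covariance -/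

section Entry

variable {V M : ℕ} [NeZero V] [NeZero M]

omit [NeZero V] [NeZero M] in
/-- **Pointwise increment of the slice symbol on the frequency–momentum labels**: `|e_{K′} − e_K| ≤ P₀` everywhere gives
`‖Ψ̂_{(Λ,Λ′]}(ω, e_{K′}(k⃗)) − Ψ̂_{(Λ,Λ′]}(ω, e_K(k⃗))‖ ≤ (16·(32/3)+16)·c/Λ²·P₀`. [cite: BenfattoGiulianiMastropietro2006, §3 (3.2)] -/
theorem norm_sliceSymbolFreqIncr_le {c Λ Λ' : ℝ} (hΛ : 0 < Λ) (hΛΛ' : Λ ≤ Λ') (hc : 0 ≤ c) {β μ : ℝ} {K K' : TrigPolyC4v}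
    {P₀ : ℝ} (hv₀ : ∀ p, |frameLevel μ K' p - frameLevel μ K p| ≤ P₀) (k : FreqMomentum V M) :
    ‖sliceSymbolFnXi c 0 Λ Λ' (matsubaraFreq β M k.1) (nambuXiCT V μ K' k.2) -
        sliceSymbolFnXi c 0 Λ Λ' (matsubaraFreq β M k.1) (nambuXiCT V μ K k.2)‖ ≤ (16 * (32 / 3) + 16) * c / Λ ^ 2 * P₀ := by
  have hB₁ : ∀ x, |deriv salmhoferCutoff x| ≤ 32 / 3 := klcd_abs_deriv_salmhoferCutoff_le_sharp
  have e : nambuXiCT V μ K' k.2 = nambuXiCT V μ K k.2 + (nambuXiCT V μ K' k.2 - nambuXiCT V μ K k.2) := by ring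
  rw [e]
  refine (norm_sliceSymbolFnXi_sub_le hΛ hΛΛ' (abs_zero_le_quarter hΛ) hc hB₁ _ _).trans (mul_le_mul_of_nonneg_left ?_ (by positivity))
  rw [nambuXiCT_sub_eq]
  exact hv₀ _

omit [NeZero M] in
/-- **The closed shell of an admissible frame on the frequency–momentum labels** (`0 ≤ Λ′ < 3/80`):
`#{k : |ω(k₁)| ≤ Λ′ ∧ |e_K(k₂)| ≤ Λ′} ≤ (Λ′β/π + 3)·(1793Λ′V² + 704V)`. [cite: BenfattoGiulianiMastropietro2006, §2.8 (2.80)] -/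
theorem card_shell_freqMomentum_le {R : RenConsts} {U : ℝ} {N : ℕ} {μ : ℝ} {K : TrigPolyC4v} (hK : FrameOK R U N μ K) {β : ℝ} (hβ : 0 < β)
    {Λ' : ℝ} (hΛ'0 : 0 ≤ Λ') (hΛ' : Λ' < 3 / 80) :
    ((((univ : Finset (FreqMomentum V M)).filter fun k => |matsubaraFreq β M k.1| ≤ Λ' ∧ |nambuXiCT V μ K k.2| ≤ Λ').card : ℕ) : ℝ) ≤
      (Λ' * β / π + 3) * (1793 * Λ' * (V : ℝ) ^ 2 + 704 * V) := by
  have h3 := card_filter_freqMomentum_eq (L := V) (M := M) (fun i : MatsubaraIdx M => |matsubaraFreq β M i| ≤ Λ')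
    (fun k : TorusSite 2 V => |nambuXiCT V μ K k| ≤ Λ')
  have hT : ((((univ : Finset (MatsubaraIdx M)).filter fun i => |matsubaraFreq β M i| ≤ Λ').card : ℕ) : ℝ) ≤ Λ' * β / π + 3 :=
    card_filter_matsubaraFreq_le hβ hΛ'0 _ fun i hi => (mem_filter.1 hi).2
  have hS : ((((univ : Finset (TorusSite 2 V)).filter fun k => |nambuXiCT V μ K k| ≤ Λ').card : ℕ) : ℝ) ≤ 1793 * Λ' * (V : ℝ) ^ 2 + 704 * V :=
    card_frameLevel_le_le hK hΛ'0 hΛ'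
  calc _ = ((((univ : Finset (MatsubaraIdx M)).filter fun i => |matsubaraFreq β M i| ≤ Λ').card : ℕ) : ℝ) *
        ((((univ : Finset (TorusSite 2 V)).filter fun k => |nambuXiCT V μ K k| ≤ Λ').card : ℕ) : ℝ) := by rw [h3]; push_cast; ring
    _ ≤ _ := mul_le_mul hT hS (Nat.cast_nonneg _) (by positivity)

omit [NeZero M] in
/-- **Sum of the symbol increment over all frequency–momentum labels**: the increment is supported in `shell[K] ∪ shell[K′]` (two admissible frames) and
pointwise `≤ (16·(32/3)+16)·c/Λ²·P₀`, so `Σ_k ‖Ψ̂[K′](k) − Ψ̂[K](k)‖ ≤ 2(Λ′β/π+3)(1793Λ′V²+704V)·(16·(32/3)+16)·c/Λ²·P₀`.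
[cite: BenfattoGiulianiMastropietro2006, §2.8 (2.80), §3 (3.2)–(3.3)] -/
theorem sum_norm_sliceSymbolFreqIncr_le {R R' : RenConsts} {U U' : ℝ} {N N' : ℕ} {μ : ℝ} {K K' : TrigPolyC4v}
    (hK : FrameOK R U N μ K) (hK' : FrameOK R' U' N' μ K') {β : ℝ} (hβ : 0 < β) {c : ℝ} (hc : 0 ≤ c) {Λ Λ' : ℝ} (hΛ : 0 < Λ)
    (hΛΛ' : Λ ≤ Λ') (hΛ' : Λ' < 3 / 80) {P₀ : ℝ} (hP₀ : 0 ≤ P₀) (hv₀ : ∀ p, |frameLevel μ K' p - frameLevel μ K p| ≤ P₀) :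
    ∑ k : FreqMomentum V M, ‖sliceSymbolFnXi c 0 Λ Λ' (matsubaraFreq β M k.1) (nambuXiCT V μ K' k.2) -
        sliceSymbolFnXi c 0 Λ Λ' (matsubaraFreq β M k.1) (nambuXiCT V μ K k.2)‖ ≤
      2 * ((Λ' * β / π + 3) * (1793 * Λ' * (V : ℝ) ^ 2 + 704 * V)) * ((16 * (32 / 3) + 16) * c / Λ ^ 2 * P₀) := by
  have hΛ'0 : 0 ≤ Λ' := hΛ.le.trans hΛΛ'
  set f : FreqMomentum V M → ℝ := fun k => ‖sliceSymbolFnXi c 0 Λ Λ' (matsubaraFreq β M k.1) (nambuXiCT V μ K' k.2) -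
    sliceSymbolFnXi c 0 Λ Λ' (matsubaraFreq β M k.1) (nambuXiCT V μ K k.2)‖ with hf
  set A := (univ : Finset (FreqMomentum V M)).filter fun k => |matsubaraFreq β M k.1| ≤ Λ' ∧ |nambuXiCT V μ K' k.2| ≤ Λ' with hA
  set B := (univ : Finset (FreqMomentum V M)).filter fun k => |matsubaraFreq β M k.1| ≤ Λ' ∧ |nambuXiCT V μ K k.2| ≤ Λ' with hB
  set S : ℝ := (16 * (32 / 3) + 16) * c / Λ ^ 2 * P₀ with hS
  have hS0 : 0 ≤ S := by rw [hS]; positivity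
  -- off the two shells the increment vanishes
  have hzero : ∀ k : FreqMomentum V M, k ∉ A ∪ B → f k = 0 := by
    intro k hk
    rw [Finset.mem_union, not_or, hA, hB, mem_filter, mem_filter] at hk
    obtain ⟨hkA, hkB⟩ := hk
    have h1 : sliceSymbolFnXi c 0 Λ Λ' (matsubaraFreq β M k.1) (nambuXiCT V μ K' k.2) = 0 :=
      sliceSymbolFnXi_eq_zero_of_not_shell hΛ hΛΛ' fun h => hkA ⟨mem_univ _, h⟩
    have h2 : sliceSymbolFnXi c 0 Λ Λ' (matsubaraFreq β M k.1) (nambuXiCT V μ K k.2) = 0 :=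
      sliceSymbolFnXi_eq_zero_of_not_shell hΛ hΛΛ' fun h => hkB ⟨mem_univ _, h⟩
    simp only [hf, h1, h2, sub_zero, norm_zero]
  have hsum : ∑ k, f k = ∑ k ∈ A ∪ B, f k := (Finset.sum_subset (subset_univ _) fun k _ hk => hzero k hk).symm
  have hAc : ((A.card : ℕ) : ℝ) ≤ (Λ' * β / π + 3) * (1793 * Λ' * (V : ℝ) ^ 2 + 704 * V) := card_shell_freqMomentum_le hK' hβ hΛ'0 hΛ'
  have hBc : ((B.card : ℕ) : ℝ) ≤ (Λ' * β / π + 3) * (1793 * Λ' * (V : ℝ) ^ 2 + 704 * V) := card_shell_freqMomentum_le hK hβ hΛ'0 hΛ'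
  have hUc : (((A ∪ B).card : ℕ) : ℝ) ≤ 2 * ((Λ' * β / π + 3) * (1793 * Λ' * (V : ℝ) ^ 2 + 704 * V)) := by
    have h := Finset.card_union_le A B
    have h' : (((A ∪ B).card : ℕ) : ℝ) ≤ ((A.card : ℕ) : ℝ) + ((B.card : ℕ) : ℝ) := by exact_mod_cast h
    linarith
  show ∑ k, f k ≤ _
  rw [hsum]
  calc ∑ k ∈ A ∪ B, f k ≤ ∑ _k ∈ A ∪ B, S := sum_le_sum fun k _ => norm_sliceSymbolFreqIncr_le hΛ hΛΛ' hc hv₀ k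
    _ = (((A ∪ B).card : ℕ) : ℝ) * S := by rw [sum_const, nsmul_eq_mul]
    _ ≤ 2 * ((Λ' * β / π + 3) * (1793 * Λ' * (V : ℝ) ^ 2 + 704 * V)) * S := mul_le_mul_of_nonneg_right hUc hS0

/-- **ENTRIES OF THE TWO-FRAME INCREMENT OF THE FIRST STEP COVARIANCE** (two admissible frames, `|e_{K′} − e_K| ≤ P₀`, `β > 0`):
`‖(klStepCov V M β μ K′ 0 − klStepCov V M β μ K 0) X Y‖ ≤ (βV²)⁻²·2(Λ₁β/π+3)(1793Λ₁V²+704V)·(16·(32/3)+16)·βV²/Λ₂²·P₀`.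
[cite: BenfattoGiulianiMastropietro2006, §2.7 (2.66)–(2.67), §2.8 (2.80), §3 (3.2)–(3.3)] -/
theorem norm_klStepCov_zero_sub_apply_le {R R' : RenConsts} {U U' : ℝ} {N N' : ℕ} {μ : ℝ} {K K' : TrigPolyC4v}
    (hK : FrameOK R U N μ K) (hK' : FrameOK R' U' N' μ K') {β : ℝ} (hβ : 0 < β) {P₀ : ℝ} (hP₀ : 0 ≤ P₀)
    (hv₀ : ∀ p, |frameLevel μ K' p - frameLevel μ K p| ≤ P₀) (X Y : SpaceTimeIdx V M × SectorLeg (sectorCount 0)) :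
    ‖(klStepCov V M β μ K' 0 - klStepCov V M β μ K 0) X Y‖ ≤
      (1 / (β * (V : ℝ) ^ 2)) ^ 2 * (2 * ((klScale klE0 1 * β / π + 3) * (1793 * klScale klE0 1 * (V : ℝ) ^ 2 + 704 * V)) *
        ((16 * (32 / 3) + 16) * (β * (V : ℝ) ^ 2) / klScale klE0 2 ^ 2 * P₀)) := by
  have he : (0 : ℝ) < klE0 := by norm_num [klE0]
  have hΛ2 : 0 < klScale klE0 2 := klth_klScale_pos 2
  have hΛ21 : klScale klE0 2 ≤ klScale klE0 1 := EngineV8.klScale_le_klScale he.le (by norm_num)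
  have hΛ1t : klScale klE0 1 < 3 / 80 := klScale_klE0_lt_tube 1
  rw [klStepCov_zero_sub_eq hβ.ne' μ K K']
  have h1 := norm_sectorSub_pullback_normalCovariance_le_of_sum (L := V) (M := M) β
    (fun (_ : Fin (sectorCount 0)) (_ : FreqMomentum V M) => (1 : ℂ)) (fun _ _ => by rw [norm_one])
    (fun ks : FreqMomentum V M × Fin 2 =>
      sliceSymbolFnXi (β * (V : ℝ) ^ 2) 0 (klScale klE0 2) (klScale klE0 1) (matsubaraFreq β M ks.1.1) (nambuXiCT V μ K' ks.1.2) -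
        sliceSymbolFnXi (β * (V : ℝ) ^ 2) 0 (klScale klE0 2) (klScale klE0 1) (matsubaraFreq β M ks.1.1) (nambuXiCT V μ K ks.1.2)) X Y
  refine h1.trans ?_
  have hc0 : ‖((1 / (β * (V : ℝ) ^ 2) : ℝ) : ℂ)‖ = 1 / (β * (V : ℝ) ^ 2) := by
    rw [Complex.norm_real, Real.norm_of_nonneg (by positivity)]
  rw [hc0]
  refine mul_le_mul_of_nonneg_left ?_ (by positivity)
  have hfilter : ((Finset.univ : Finset (FreqMomentum V M)).filter fun _ => (1 : ℂ) ≠ 0) = Finset.univ :=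
    filter_true_of_mem fun _ _ => one_ne_zero
  rw [hfilter]
  exact sum_norm_sliceSymbolFreqIncr_le hK hK' hβ (by positivity) hΛ2 hΛ21 hΛ1t hP₀ hv₀

/-- **ENTRIES, VOLUME-FREE FORM** (`β ≥ 1`): `‖(klStepCov V M β μ K′ 0 − klStepCov V M β μ K 0) X Y‖ ≤ 𝒞ₑ·P₀`,
`𝒞ₑ = 2(Λ₁/π+3)(1793Λ₁+704)·((16·(32/3)+16)/Λ₂²)` — uniform in `V`, `M`, `β`. [cite: BenfattoGiulianiMastropietro2006, §2.8 (2.80), §3 (3.2)–(3.3)] -/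
theorem norm_klStepCov_zero_sub_apply_le_unif {R R' : RenConsts} {U U' : ℝ} {N N' : ℕ} {μ : ℝ} {K K' : TrigPolyC4v}
    (hK : FrameOK R U N μ K) (hK' : FrameOK R' U' N' μ K') {β : ℝ} (hβ1 : 1 ≤ β) {P₀ : ℝ} (hP₀ : 0 ≤ P₀)
    (hv₀ : ∀ p, |frameLevel μ K' p - frameLevel μ K p| ≤ P₀) (X Y : SpaceTimeIdx V M × SectorLeg (sectorCount 0)) :
    ‖(klStepCov V M β μ K' 0 - klStepCov V M β μ K 0) X Y‖ ≤
      2 * (klScale klE0 1 / π + 3) * (1793 * klScale klE0 1 + 704) * ((16 * (32 / 3) + 16) / klScale klE0 2 ^ 2) * P₀ := by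
  have hβ : 0 < β := lt_of_lt_of_le one_pos hβ1
  have hV1 : (1 : ℝ) ≤ V := by exact_mod_cast Nat.pos_of_ne_zero (NeZero.ne V)
  have hV : (0 : ℝ) < V := lt_of_lt_of_le one_pos hV1
  have hΛ1 : 0 < klScale klE0 1 := klth_klScale_pos 1
  have hΛ2 : 0 < klScale klE0 2 := klth_klScale_pos 2
  refine (norm_klStepCov_zero_sub_apply_le hK hK' hβ hP₀ hv₀ X Y).trans ?_
  -- `(Λ₁β/π+3) ≤ (Λ₁/π+3)·β` and `(1793Λ₁V²+704V) ≤ (1793Λ₁+704)·V²`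
  have h1 : klScale klE0 1 * β / π + 3 ≤ (klScale klE0 1 / π + 3) * β := by
    rw [add_mul, div_mul_eq_mul_div, mul_comm (klScale klE0 1) β, mul_div_assoc]
    have : (3 : ℝ) ≤ 3 * β := by nlinarith
    nlinarith [this]
  have h2 : 1793 * klScale klE0 1 * (V : ℝ) ^ 2 + 704 * V ≤ (1793 * klScale klE0 1 + 704) * (V : ℝ) ^ 2 := by
    have : (704 : ℝ) * V ≤ 704 * (V : ℝ) ^ 2 := by nlinarith
    nlinarith [this]
  have hA0 : 0 ≤ klScale klE0 1 * β / π + 3 := by positivity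
  have hB0 : 0 ≤ 1793 * klScale klE0 1 * (V : ℝ) ^ 2 + 704 * V := by positivity
  calc (1 / (β * (V : ℝ) ^ 2)) ^ 2 * (2 * ((klScale klE0 1 * β / π + 3) * (1793 * klScale klE0 1 * (V : ℝ) ^ 2 + 704 * V)) *
          ((16 * (32 / 3) + 16) * (β * (V : ℝ) ^ 2) / klScale klE0 2 ^ 2 * P₀))
      ≤ (1 / (β * (V : ℝ) ^ 2)) ^ 2 * (2 * (((klScale klE0 1 / π + 3) * β) * ((1793 * klScale klE0 1 + 704) * (V : ℝ) ^ 2)) *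
          ((16 * (32 / 3) + 16) * (β * (V : ℝ) ^ 2) / klScale klE0 2 ^ 2 * P₀)) := by
        gcongr
    _ = 2 * (klScale klE0 1 / π + 3) * (1793 * klScale klE0 1 + 704) * ((16 * (32 / 3) + 16) / klScale klE0 2 ^ 2) * P₀ := by
        field_simp

end Entry

/-! ## §2 Plain rows and columns of the two-frame increment in the two-scale class `(G₀, x)` -/

section RowsCols

/-- **PLAIN ROWS AND COLUMNS OF THE TWO-FRAME INCREMENT OF THE FIRST STEP COVARIANCE** from the jets of the two frames: `∃ Cr > 0` (absolute, given the
third-jet slope `K₃ˢ`) such that for every base frame `K` (`FrameOK`, `‖D³e_K‖ ≤ K₃ˢ·x`) and frame `K′` (`FrameOK`) with increment jets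
`|e_{K′}−e_K| ≤ G₀/x²`, `‖∇(e_{K′}−e_K)‖ ≤ G₀/x`, `‖D²(e_{K′}−e_K)‖ ≤ G₀`, `‖D³(e_{K′}−e_K)‖ ≤ G₀·x` (`0 ≤ G₀ ≤ 1 ≤ x`), every `klBetaMin ≤ β ≤ M`:
`Σ_Y ‖(klStepCov V M β μ K′ 0 − klStepCov V M β μ K 0) X Y‖ ≤ Cr·(M/β)·(G₀/x)` and the same for columns (p3 g17's weighted `ℓ¹` bound of the increment
character sum, read at weight `1`). [cite: BenfattoGiulianiMastropietro2006, §2.7 (2.66)–(2.67), §3 (3.2)–(3.3)] -/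
theorem rowCol_klStepCov_zero_sub_le_of_jets (K₃s : ℝ) (hK₃s : 0 ≤ K₃s) :
    ∃ Cr : ℝ, 0 < Cr ∧
      ∀ (V M : ℕ) [NeZero V] [NeZero M] (R : RenConsts) (U : ℝ) (N : ℕ) (R' : RenConsts) (U' : ℝ) (N' : ℕ) (μ : ℝ) (K K' : TrigPolyC4v),
      FrameOK R U N μ K → FrameOK R' U' N' μ K' →
      ∀ (G₀ x : ℝ), 0 ≤ G₀ → G₀ ≤ 1 → 1 ≤ x →
      (∀ p, ‖iteratedFDeriv ℝ 3 (frameLevel μ K) p‖ ≤ K₃s * x) →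
      (∀ p, |frameLevel μ K' p - frameLevel μ K p| ≤ G₀ / x ^ 2) →
      (∀ p, ‖fderiv ℝ (fun p => frameLevel μ K' p - frameLevel μ K p) p‖ ≤ G₀ / x) →
      (∀ p, ‖iteratedFDeriv ℝ 2 (fun p => frameLevel μ K' p - frameLevel μ K p) p‖ ≤ G₀) →
      (∀ p, ‖iteratedFDeriv ℝ 3 (fun p => frameLevel μ K' p - frameLevel μ K p) p‖ ≤ G₀ * x) →
      ∀ β : ℝ, klBetaMin ≤ β → β ≤ (M : ℝ) →
        (∀ X : SpaceTimeIdx V M × SectorLeg (sectorCount 0), ∑ Y : SpaceTimeIdx V M × SectorLeg (sectorCount 0),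
            ‖(klStepCov V M β μ K' 0 - klStepCov V M β μ K 0) X Y‖ ≤ Cr * ((M : ℝ) / β) * (G₀ / x)) ∧
        (∀ Y : SpaceTimeIdx V M × SectorLeg (sectorCount 0), ∑ X : SpaceTimeIdx V M × SectorLeg (sectorCount 0),
            ‖(klStepCov V M β μ K' 0 - klStepCov V M β μ K 0) X Y‖ ≤ Cr * ((M : ℝ) / β) * (G₀ / x)) := by
  obtain ⟨Cd, sd, hCd, hsd, hsd1, hincr⟩ := incrSlice_wt_l1_le K₃s hK₃s
  refine ⟨16 * Cd, by positivity, ?_⟩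
  intro V M _ _ R U N R' U' N' μ K K' hK hK' G₀ x hG hG1 hx hK3 h0 h1 h2 h3 β hβmin hβM
  have hβ : 0 < β := pos_of_klBetaMin_le hβmin
  have hT := hincr V M R U N R' U' N' μ K K' hK hK' G₀ x hG hG1 hx hK3 h0 h1 h2 h3 β hβmin hβM
  -- read the weighted bound at weight `1`
  have hT1 : ∑ z : TorusSite 1 (2 * M) × TorusSite 2 V, (fun _ : TorusSite 1 (2 * M) × TorusSite 2 V => (1 : ℝ)) z *
      ‖∑ q : TorusSite 1 (2 * M) × TorusSite 2 V, (torusChar q.1 z.1 * torusChar q.2 z.2) •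
        ((((1 / (β * (V : ℝ) ^ 2) : ℝ) : ℂ) ^ 2 *
          (sliceSymbolFnXi (β * (V : ℝ) ^ 2) 0 (klScale klE0 2) (klScale klE0 1) (matsubaraFreq β M ⟨(q.1 0).val, ZMod.val_lt (q.1 0)⟩)
              (nambuXiCT V μ K' q.2) -
            sliceSymbolFnXi (β * (V : ℝ) ^ 2) 0 (klScale klE0 2) (klScale klE0 1) (matsubaraFreq β M ⟨(q.1 0).val, ZMod.val_lt (q.1 0)⟩)
              (nambuXiCT V μ K q.2))))‖ ≤ Cd * ((M : ℝ) / β) * (G₀ / x) := by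
    refine le_trans (Finset.sum_le_sum fun z _ => mul_le_mul_of_nonneg_right ?_ (norm_nonneg _)) hT
    have ha : 0 ≤ sd / x * |(((z.2 0).valMinAbs : ℤ) : ℝ)| := by positivity
    have hb : 0 ≤ sd / x * |(((z.2 1).valMinAbs : ℤ) : ℝ)| := by positivity
    linarith
  have hw0 : ∀ z : TorusSite 1 (2 * M) × TorusSite 2 V, 0 ≤ (fun _ : TorusSite 1 (2 * M) × TorusSite 2 V => (1 : ℝ)) z := fun _ => zero_le_one
  have hwev : ∀ (a : TorusSite 1 (2 * M)) (b : TorusSite 2 V), (fun _ : TorusSite 1 (2 * M) × TorusSite 2 V => (1 : ℝ)) (-a, -b) =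
      (fun _ : TorusSite 1 (2 * M) × TorusSite 2 V => (1 : ℝ)) (a, b) := fun _ _ => rfl
  refine ⟨fun X => ?_, fun Y => ?_⟩
  · have h := rowSumWt_klStepCov_zero_sub_le hβ.ne' μ K K' _ hw0 hwev hT1 X
    simp only [mul_one] at h
    calc _ ≤ 16 * (Cd * ((M : ℝ) / β) * (G₀ / x)) := h
      _ = 16 * Cd * ((M : ℝ) / β) * (G₀ / x) := by ring
  · have h := colSumWt_klStepCov_zero_sub_le hβ.ne' μ K K' _ hw0 hwev hT1 Y
    simp only [mul_one] at h
    calc _ ≤ 16 * (Cd * ((M : ℝ) / β) * (G₀ / x)) := h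
      _ = 16 * Cd * ((M : ℝ) / β) * (G₀ / x) := by ring

end RowsCols

end Summit.HubbardSuperconductivity.HubbardSuperconductivity.Theorems.TorusFourierL2

end
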